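import Literature.MathematicalPhysics.QuantumLattice.HubbardTTPrimeGrandCanonicalPressure
import Literature.MathematicalPhysics.QuantumLattice.HubbardTTPrimeThermalPressureSpinSectorsConcave
import HarnessLib

/-!
# The grand-canonical pressure of the 2D `t–t'` Hubbard model in a Zeeman field exists and is the two-variable
# Legendre transform of the spin-resolved canonical pressure:
# `P(β; t,t',U; μ, h) = sup_{(n↑,n↓)} [p(β; n↑, n↓) + βμ(n↑ + n↓) + βh(n↑ − n↓)]`

Topic `MathematicalPhysics/QuantumLattice` (family `hubbard`); the Zeeman-field form of
`HubbardTTPrimeGrandCanonicalPressure.lean` (which is the case `h = 0`). The phase map of the programme is drawn over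
`T × P × H`; at the model level the field `H` couples to `N↑ − N↓`, and the `H` axis of the `T > 0` state functions is
the second Legendre variable of the spin-resolved canonical pressure `p(β; t,t',U; x, y) = pressureTT'₂ β t t' U x y`
(`HubbardTTPrimeThermalPressureSpinSectors.lean`). For the `L × L` torus, `H_L = hubbardRectTorusTT' L L t t' U`,
`N = totalNumber`, `M = spinImbalance = Σ_x (n_{x↑} − n_{x↓})`, `Ξ_L(β,μ,h) = Re Z_β(H_L − μN − hM)`:

* §1 the sector decomposition `Re Z_β(A − μN − hM) = Σ_{a,b ≤ |Λ|} e^{β(μ(a+b)+h(a−b))} Re Z_β(A; a, b)`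
  (`partitionFn_sub_sub_re_eq_sum`), the one-term floor `log_partitionFn_spinSector_le_grandCanonicalZeeman`, and the
  polynomial ceiling `log_partitionFn_grandCanonicalZeeman_le_of_forall`;
* §2 the uniformity of the canonical limit over the spin sectors with the two-coefficient linear functional
  (`eventually_forall_sector_le_sSup_zeeman`; same equicontinuity argument as for `h = 0`);
* §3 **`tendsto_torusGCPressureTT'Zeeman`**: `L⁻² log Ξ_L(β,μ,h) → gcPressureTT'Zeeman β t t' U μ h :=
  sup_{x,y ∈ [0,1)} [p(x,y) + βμ(x+y) + βh(x−y)]` (`β ≥ 0`, `U ≥ 0`, all real `μ, h`); the certificate dictionary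
  `gcPressureTT'Zeeman_le_of_eventually` / `le_gcPressureTT'Zeeman_of_eventually`; `pressureTT'₂_add_le_gcPressureTT'Zeeman`,
  `pressureTT'_add_le_gcPressureTT'Zeeman`, `gcPressureTT'Zeeman_le_iff`.

* §4 the field axis: `gcPressureTT'Zeeman_zero` (`h = 0` is `gcPressureTT'`), `gcPressureTT'Zeeman_neg` (even in `h`, by the
  spin-flip symmetry `pressureTT'₂_swap`), `gcPressureTT'Zeeman_zero_le` / `gcPressureTT'_le_gcPressureTT'Zeeman` (a field never
  lowers the pressure), `convexOn_gcPressureTT'Zeeman` (jointly convex in `(μ, h)`).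

With the joint concavity of `p` (`concaveOn_pressureTT'₂`, `HubbardTTPrimeThermalPressureSpinSectorsConcave.lean`) this is
the full `(μ, h) ↔ (n, m)` convex duality of the `T > 0` state functions. Everything is PROVED; two real definitions
(`torusGCPressureTT'Zeeman`, `gcPressureTT'Zeeman`) and one operator abbreviation (`spinImbalance`), no named fact.

## Mathlib / tree search

REUSED: `sum_sum_spinSectorProj_eq_one`, `re_trace_spinSectorProj_mul_gibbsWeight_eq`, `abs_interactionEntropy_sub_le_fst/_snd`,
`pressureTT'₂_le_apriori`, `tendsto_spinSectorPressureTT'`, `pressureTT'₂_half_half` (tree), `sum_numberAt_up_eq_diagonal`,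
`sum_numberAt_down_eq_diagonal` (`SpinSectorPartitionFnTransfer`), `partitionFn_add_smul_one`, Mathlib
`IsCompact.uniformContinuousOn_of_continuous`, `Filter.eventually_all`. `lean search 'Zeeman.*pressure|spinImbalance'`:
`spinImbalanceInteraction` (infinite volume, `TIGroundEnergyDensityConservedDensities`) only (2026-08-27).

## References

* D. Ruelle, *Statistical Mechanics: Rigorous Results* (1969), §3.4. [cite: Ruelle1969, §3.4]
* R. B. Israel, *Convexity in the Theory of Lattice Gases* (1979), Thm. I.2.4, Lemma II.3.1. [cite: Israel1979, Thm. I.2.4]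
* E. H. Lieb, Phys. Rev. Lett. 62 (1989) 1201, proof of Theorem 1 (the `(N↑, N↓)` sectors). [cite: LiebPRL1989, proof of Theorem 1]
-/

noncomputable section

namespace Literature.MathematicalPhysics.QuantumLattice

open Matrix Finset HubbardWave0 Literature.Probability.LatticeModels LiebThm1
open _root_.Filter
open scoped _root_.Topology ComplexOrder BigOperators

/-! ### §1 The spin imbalance and the sector decomposition with a Zeeman field -/

section SectorDecomposition

variable {Λ : Type*} [LinearOrder Λ] [Fintype Λ]

/-- The spin imbalance (twice `S^z`): `M = Σ_x (n_{x↑} − n_{x↓}) = N↑ − N↓`. [cite: LiebPRL1989, proof of Theorem 1] -/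
def spinImbalance : Matrix (Finset (Orb Λ)) (Finset (Orb Λ)) ℂ := ∑ x : Λ, (numberOp x 0 - numberOp x 1)

/-- `M` is diagonal with entry `N↑(s) − N↓(s)`. [cite: LiebPRL1989, proof of Theorem 1] -/
theorem spinImbalance_eq_diagonal :
    (spinImbalance : Matrix (Finset (Orb Λ)) (Finset (Orb Λ)) ℂ) =
      diagonal fun s => ((upPart s).card : ℂ) - ((downPart s).card : ℂ) := by
  rw [spinImbalance, Finset.sum_sub_distrib]
  change (∑ x : Λ, numberAt (orb x 0)) - (∑ x : Λ, numberAt (orb x 1)) = _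
  rw [sum_numberAt_up_eq_diagonal, sum_numberAt_down_eq_diagonal]
  ext s u
  simp only [Matrix.sub_apply, diagonal_apply]
  split_ifs <;> simp

/-- The compression of `A − μN − hM` to the sector `(a, b)` is the compression of `A` shifted by `−μ(a+b) − h(a−b)`.
[cite: Ruelle1969, §3.4] -/
theorem spinSectorHamiltonian_sub_sub (a b : ℕ) (A : Matrix (Finset (Orb Λ)) (Finset (Orb Λ)) ℂ) (μ hz : ℝ) :
    spinSectorHamiltonian a b (A - (μ : ℂ) • totalNumber - (hz : ℂ) • spinImbalance) =
      spinSectorHamiltonian a b A + ((-(μ * (a + b) + hz * (a - b)) : ℝ) : ℂ) • 1 := by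
  ext ⟨s, hs⟩ ⟨u, hu⟩
  simp only [spinSectorHamiltonian, submatrix_apply, Matrix.sub_apply, Matrix.add_apply, Matrix.smul_apply,
    totalNumber_eq_diagonal, spinImbalance_eq_diagonal, diagonal_apply, Matrix.one_apply, Subtype.mk.injEq, smul_eq_mul]
  by_cases hsu : s = u
  · subst hsu
    simp only [if_true, hs.1, hs.2]
    push_cast
    ring
  · simp [hsu]

/-- Hence `Re Z_β((A − μN − hM)|_{(a,b)}) = e^{β(μ(a+b) + h(a−b))} Re Z_β(A|_{(a,b)})`. [cite: Ruelle1969, §3.4] -/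
theorem partitionFn_spinSector_sub_sub_re (a b : ℕ) (A : Matrix (Finset (Orb Λ)) (Finset (Orb Λ)) ℂ) (β μ hz : ℝ) :
    (partitionFn β (spinSectorHamiltonian a b (A - (μ : ℂ) • totalNumber - (hz : ℂ) • spinImbalance))).re =
      Real.exp (β * μ * (a + b) + β * hz * (a - b)) * (partitionFn β (spinSectorHamiltonian a b A)).re := by
  rw [spinSectorHamiltonian_sub_sub, partitionFn_add_smul_one, Complex.re_ofReal_mul]
  congr 1
  congr 1
  ring

/-- `A − μN − hM` preserves the spin sectors when `A` does. [cite: LiebPRL1989, Remark (2)] -/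
theorem preservesSectors_sub_sub {A : Matrix (Finset (Orb Λ)) (Finset (Orb Λ)) ℂ} (hP : PreservesSectors A) (μ hz : ℂ) :
    PreservesSectors (A - μ • totalNumber - hz • spinImbalance) := by
  rw [sub_eq_add_neg, sub_eq_add_neg, ← neg_smul, ← neg_smul, totalNumber_eq_diagonal, spinImbalance_eq_diagonal]
  exact (hP.add ((PreservesSectors.diagonal _).smul _)).add ((PreservesSectors.diagonal _).smul _)

/-- `A − μN − hM` is Hermitian for Hermitian `A` and real `μ, h`. [cite: Ruelle1969, §3.4] -/
theorem isHermitian_sub_sub {A : Matrix (Finset (Orb Λ)) (Finset (Orb Λ)) ℂ} (hA : A.IsHermitian) (μ hz : ℝ) :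
    (A - (μ : ℂ) • totalNumber - (hz : ℂ) • spinImbalance).IsHermitian := by
  have hN : (totalNumber : Matrix (Finset (Orb Λ)) (Finset (Orb Λ)) ℂ).IsHermitian := totalNumber_isHermitian
  have hM : (spinImbalance : Matrix (Finset (Orb Λ)) (Finset (Orb Λ)) ℂ).IsHermitian := by
    rw [spinImbalance_eq_diagonal]
    refine Matrix.isHermitian_diagonal_iff.2 fun s => ?_
    rw [IsSelfAdjoint, star_sub, Complex.star_def, map_natCast, map_natCast]
  refine (hA.sub (hN.smul ?_)).sub (hM.smul ?_)
  · rw [isSelfAdjoint_iff, Complex.star_def, Complex.conj_ofReal]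
  · rw [isSelfAdjoint_iff, Complex.star_def, Complex.conj_ofReal]

/-- **Sector decomposition with a Zeeman field**: for a sector-preserving `A`,
`Re Z_β(A − μN − hM) = Σ_{a ≤ |Λ|} Σ_{b ≤ |Λ|} e^{β(μ(a+b) + h(a−b))} Re Z_β(A; a, b)`. [cite: Ruelle1969, §3.4] -/
theorem partitionFn_sub_sub_re_eq_sum {A : Matrix (Finset (Orb Λ)) (Finset (Orb Λ)) ℂ} (hP : PreservesSectors A)
    (β μ hz : ℝ) :
    (partitionFn β (A - (μ : ℂ) • totalNumber - (hz : ℂ) • spinImbalance)).re =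
      ∑ a ∈ Finset.range (Fintype.card Λ + 1), ∑ b ∈ Finset.range (Fintype.card Λ + 1),
        Real.exp (β * μ * (a + b) + β * hz * (a - b)) * (partitionFn β (spinSectorHamiltonian a b A)).re := by
  set K := A - (μ : ℂ) • totalNumber - (hz : ℂ) • spinImbalance with hK
  have hKP : PreservesSectors K := preservesSectors_sub_sub hP μ hz
  have h1 : partitionFn β K = ((∑ a ∈ Finset.range (Fintype.card Λ + 1),
      ∑ b ∈ Finset.range (Fintype.card Λ + 1),
        (spinSectorProj a b : Matrix (Finset (Orb Λ)) (Finset (Orb Λ)) ℂ)) * gibbsWeight β K).trace := by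
    rw [sum_sum_spinSectorProj_eq_one, Matrix.one_mul]; rfl
  rw [h1, Finset.sum_mul, Matrix.trace_sum, Complex.re_sum]
  refine Finset.sum_congr rfl fun a _ => ?_
  rw [Finset.sum_mul, Matrix.trace_sum, Complex.re_sum]
  refine Finset.sum_congr rfl fun b _ => ?_
  rw [re_trace_spinSectorProj_mul_gibbsWeight_eq hKP, hK, partitionFn_spinSector_sub_sub_re]

/-- **One sector term under the Zeeman grand-canonical trace** (nonempty sector, Hermitian sector-preserving `A`):
`log Re Z_β(A; a,b) ≤ log Re Z_β(A − μN − hM) − (βμ(a+b) + βh(a−b))`. [cite: Ruelle1969, §3.4] -/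
theorem log_partitionFn_spinSector_le_grandCanonicalZeeman {a b : ℕ} [hne : Nonempty (Subtype (spinConfig (Λ := Λ) a b))]
    {A : Matrix (Finset (Orb Λ)) (Finset (Orb Λ)) ℂ} (hA : A.IsHermitian) (hP : PreservesSectors A) (β μ hz : ℝ) :
    Real.log (partitionFn β (spinSectorHamiltonian a b A)).re ≤
      Real.log (partitionFn β (A - (μ : ℂ) • totalNumber - (hz : ℂ) • spinImbalance)).re -
        (β * μ * (a + b) + β * hz * (a - b)) := by
  obtain ⟨⟨s, hs⟩⟩ := id hne
  have ha : a < Fintype.card Λ + 1 := by rw [← hs.1]; exact Nat.lt_succ_of_le (Finset.card_le_univ _)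
  have hb : b < Fintype.card Λ + 1 := by rw [← hs.2]; exact Nat.lt_succ_of_le (Finset.card_le_univ _)
  have hpos : 0 < (partitionFn β (spinSectorHamiltonian a b A)).re := partitionFn_spinSector_re_pos hA β
  have hle : Real.exp (β * μ * (a + b) + β * hz * (a - b)) * (partitionFn β (spinSectorHamiltonian a b A)).re ≤
      (partitionFn β (A - (μ : ℂ) • totalNumber - (hz : ℂ) • spinImbalance)).re := by
    rw [partitionFn_sub_sub_re_eq_sum hP β μ hz]
    have hnn : ∀ a' b' : ℕ, 0 ≤ Real.exp (β * μ * (a' + b') + β * hz * (a' - b')) *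
        (partitionFn β (spinSectorHamiltonian a' b' A)).re :=
      fun a' b' => mul_nonneg (Real.exp_pos _).le (partitionFn_spinSector_re_nonneg a' b' hA β)
    calc Real.exp (β * μ * (a + b) + β * hz * (a - b)) * (partitionFn β (spinSectorHamiltonian a b A)).re
        ≤ ∑ b' ∈ Finset.range (Fintype.card Λ + 1),
            Real.exp (β * μ * ((a : ℝ) + (b' : ℕ)) + β * hz * ((a : ℝ) - (b' : ℕ))) *
              (partitionFn β (spinSectorHamiltonian a b' A)).re :=
          Finset.single_le_sum (f := fun b' : ℕ => Real.exp (β * μ * ((a : ℝ) + b') + β * hz * ((a : ℝ) - b')) *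
            (partitionFn β (spinSectorHamiltonian a b' A)).re) (fun b' _ => hnn a b') (Finset.mem_range.2 hb)
      _ ≤ _ := Finset.single_le_sum (f := fun a' : ℕ => ∑ b' ∈ Finset.range (Fintype.card Λ + 1),
            Real.exp (β * μ * ((a' : ℝ) + (b' : ℕ)) + β * hz * ((a' : ℝ) - (b' : ℕ))) *
              (partitionFn β (spinSectorHamiltonian a' b' A)).re)
            (fun a' _ => Finset.sum_nonneg fun b' _ => hnn a' b') (Finset.mem_range.2 ha)
  have hlog := Real.log_le_log (mul_pos (Real.exp_pos _) hpos) hle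
  rw [Real.log_mul (Real.exp_pos _).ne' hpos.ne', Real.log_exp] at hlog
  linarith

/-- **Polynomial ceiling**: if `e^{β(μ(a+b)+h(a−b))} Re Z_β(A; a,b) ≤ e^B` for all `a, b ≤ |Λ|`, then
`log Re Z_β(A − μN − hM) ≤ 2 log(|Λ|+1) + B`. [cite: Ruelle1969, §3.4] -/
theorem log_partitionFn_grandCanonicalZeeman_le_of_forall {A : Matrix (Finset (Orb Λ)) (Finset (Orb Λ)) ℂ}
    (hA : A.IsHermitian) (hP : PreservesSectors A) (β μ hz : ℝ) {B : ℝ}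
    (hB : ∀ a b : ℕ, a ≤ Fintype.card Λ → b ≤ Fintype.card Λ →
      Real.exp (β * μ * (a + b) + β * hz * (a - b)) * (partitionFn β (spinSectorHamiltonian a b A)).re ≤ Real.exp B) :
    Real.log (partitionFn β (A - (μ : ℂ) • totalNumber - (hz : ℂ) • spinImbalance)).re ≤
      2 * Real.log ((Fintype.card Λ : ℝ) + 1) + B := by
  have hK := isHermitian_sub_sub hA μ hz
  have hpos : 0 < (partitionFn β (A - (μ : ℂ) • totalNumber - (hz : ℂ) • spinImbalance)).re := partitionFn_re_pos hK β
  rw [partitionFn_sub_sub_re_eq_sum hP β μ hz] at hpos ⊢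
  have hsum : ∑ a ∈ Finset.range (Fintype.card Λ + 1), ∑ b ∈ Finset.range (Fintype.card Λ + 1),
      Real.exp (β * μ * (a + b) + β * hz * (a - b)) * (partitionFn β (spinSectorHamiltonian a b A)).re ≤
      ((Fintype.card Λ : ℝ) + 1) ^ 2 * Real.exp B := by
    calc _ ≤ ∑ a ∈ Finset.range (Fintype.card Λ + 1), ∑ b ∈ Finset.range (Fintype.card Λ + 1), Real.exp B :=
          Finset.sum_le_sum fun a ha => Finset.sum_le_sum fun b hb =>
            hB a b (Nat.lt_succ_iff.1 (Finset.mem_range.1 ha)) (Nat.lt_succ_iff.1 (Finset.mem_range.1 hb))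
      _ = ((Fintype.card Λ : ℝ) + 1) ^ 2 * Real.exp B := by
          rw [Finset.sum_const, Finset.sum_const, Finset.card_range, smul_smul, nsmul_eq_mul]
          push_cast; ring
  calc Real.log _ ≤ Real.log (((Fintype.card Λ : ℝ) + 1) ^ 2 * Real.exp B) := Real.log_le_log hpos hsum
    _ = 2 * Real.log ((Fintype.card Λ : ℝ) + 1) + B := by
        rw [Real.log_mul (by positivity) (Real.exp_pos _).ne', Real.log_pow, Real.log_exp]; push_cast; ring

end SectorDecomposition

namespace ThermodynamicLimit

/-! ### §2 The Zeeman grand-canonical pressure; uniformity of the canonical limit over the sectors -/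

/-- `halfRectN n L ≤ n L²/2` (`0 ≤ n`). [folklore] -/
private theorem halfRectN_le_half_mul_sq' (n : ℝ) (hn0 : 0 ≤ n) (L : ℕ) :
    (halfRectN n L : ℝ) ≤ n / 2 * (L : ℝ) ^ 2 := by
  unfold halfRectN
  have h := Nat.floor_le (a := n * (L : ℝ) ^ 2 / 2) (by positivity)
  linarith

/-- `n L²/2 − 1 < halfRectN n L`. [folklore] -/
private theorem half_mul_sq_sub_one_lt_halfRectN' (n : ℝ) (L : ℕ) :
    n / 2 * (L : ℝ) ^ 2 - 1 < (halfRectN n L : ℝ) := by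
  unfold halfRectN
  have := Nat.lt_floor_add_one (n * (L : ℝ) ^ 2 / 2)
  linarith

/-- `k_L(n)/L² → n/2`. [folklore] -/
private theorem tendsto_halfRectN_div_sq₄ {n : ℝ} (hn0 : 0 ≤ n) :
    Tendsto (fun L : ℕ => (halfRectN n L : ℝ) / (L : ℝ) ^ 2) atTop (𝓝 (n / 2)) := by
  have h := (tendsto_rectN_div_sq hn0).div_const 2
  refine h.congr fun L => ?_
  have e : rectN n L = 2 * halfRectN n L := rfl
  rw [e]
  push_cast
  ring


/-- **The finite-volume grand-canonical pressure with a Zeeman field** of the `L × L` torus: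
`P_L(β; t,t',U; μ, h) = L⁻² log Re Z_β(hubbardRectTorusTT' L L t t' U − μN − h(N↑ − N↓))`. [cite: Ruelle1969, §3.4] -/
def torusGCPressureTT'Zeeman (β t t' U μ hz : ℝ) (L : ℕ) : ℝ :=
  Real.log (partitionFn β (hubbardRectTorusTT' L L t t' U - (μ : ℂ) • totalNumber - (hz : ℂ) • spinImbalance)).re /
    (L : ℝ) ^ 2

/-- **The grand-canonical pressure of the 2D `t–t'` Hubbard model in a Zeeman field** as the two-variable Legendre
transform of the spin-resolved canonical pressure:
`P(β; t,t',U; μ, h) = sup_{x, y ∈ [0,1)} [p(β; t,t',U; x, y) + βμ(x + y) + βh(x − y)]`; it is the limit of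
`torusGCPressureTT'Zeeman` (`tendsto_torusGCPressureTT'Zeeman`). [cite: Ruelle1969, §3.4] -/
def gcPressureTT'Zeeman (β t t' U μ hz : ℝ) : ℝ :=
  sSup ((fun z : ℝ × ℝ => pressureTT'₂ β t t' U z.1 z.2 + (β * μ * (z.1 + z.2) + β * hz * (z.1 - z.2))) ''
    (Set.Ico (0 : ℝ) 1 ×ˢ Set.Ico (0 : ℝ) 1))

/-- A net point within `1/(N+1)` of every `u ∈ [0,1]`, inside `[0, 1)`. [folklore] -/
private theorem exists_net_point (N : ℕ) {u : ℝ} (hu0 : 0 ≤ u) (hu1 : u ≤ 1) :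
    ∃ i : Fin (N + 1), |u - (i : ℕ) / ((N : ℝ) + 1)| ≤ 1 / ((N : ℝ) + 1) := by
  have hN : (0 : ℝ) < (N : ℝ) + 1 := by positivity
  set m : ℕ := ⌊u * ((N : ℝ) + 1)⌋₊ with hm
  have hm0 : (m : ℝ) ≤ u * ((N : ℝ) + 1) := Nat.floor_le (by positivity)
  have hm1 : u * ((N : ℝ) + 1) < (m : ℝ) + 1 := Nat.lt_floor_add_one _
  have key : ∀ k : ℕ, |u * ((N : ℝ) + 1) - k| ≤ 1 → |u - (k : ℝ) / ((N : ℝ) + 1)| ≤ 1 / ((N : ℝ) + 1) := by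
    intro k hk
    have e : u - (k : ℝ) / ((N : ℝ) + 1) = (u * ((N : ℝ) + 1) - k) / ((N : ℝ) + 1) := by field_simp
    rw [e, abs_div, abs_of_pos hN]
    exact div_le_div_of_nonneg_right hk hN.le
  by_cases hmN : m ≤ N
  · exact ⟨⟨m, Nat.lt_succ_of_le hmN⟩, key m (abs_le.2 ⟨by linarith, by linarith⟩)⟩
  · refine ⟨⟨N, Nat.lt_succ_self N⟩, key N ?_⟩
    have hmN' : (N : ℝ) + 1 ≤ m := by exact_mod_cast (show N + 1 ≤ m by omega)
    have hu : u = 1 := by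
      by_contra hne
      have hlt : u < 1 := lt_of_le_of_ne hu1 hne
      have : u * ((N : ℝ) + 1) < (N : ℝ) + 1 := by nlinarith
      linarith
    rw [hu, abs_le]
    constructor <;> linarith

/-- The binomial entropy, two-sided (`0 < M`, `a ≤ M`): `M H_b(a/M) − 2 log(M+1) ≤ log C(M,a) ≤ M H_b(a/M)`.
[cite: Israel1979, Lemma II.3.1] -/
private theorem log_choose_mem_binEntropy {M a : ℕ} (hM : 0 < M) (ha : a ≤ M) :
    (M : ℝ) * Real.binEntropy ((a : ℝ) / M) - 2 * Real.log ((M : ℝ) + 1) ≤ Real.log (M.choose a) ∧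
      Real.log (M.choose a) ≤ (M : ℝ) * Real.binEntropy ((a : ℝ) / M) :=
  ⟨le_log_choose ha hM, log_choose_le_mul_binEntropy ha⟩

/-- `c log(x²+1) ≤ η x²` eventually (`log = o(id)`). [folklore] -/
private theorem eventually_mul_log_sq_add_one_le {c η : ℝ} (hc : 0 ≤ c) (hη : 0 < η) :
    ∀ᶠ L : ℕ in atTop, c * Real.log ((L : ℝ) ^ 2 + 1) ≤ η * (L : ℝ) ^ 2 := by
  have h2 : Tendsto (fun L : ℕ => (L : ℝ) ^ 2 + 1) atTop atTop :=
    tendsto_atTop_add_const_right _ 1 ((tendsto_pow_atTop two_ne_zero).comp tendsto_natCast_atTop_atTop)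
  have hc' : (0 : ℝ) < η / (2 * (c + 1)) := by positivity
  have h3 := h2.eventually (Real.isLittleO_log_id_atTop.def hc')
  filter_upwards [h3, eventually_ge_atTop 1] with L hL hL1
  have hL1' : (1 : ℝ) ≤ (L : ℝ) ^ 2 := by
    have : (1 : ℝ) ≤ L := by exact_mod_cast hL1
    nlinarith
  have hlog0 : 0 ≤ Real.log ((L : ℝ) ^ 2 + 1) := Real.log_nonneg (by linarith)
  simp only [id, Real.norm_eq_abs] at hL
  rw [abs_of_nonneg hlog0, abs_of_nonneg (by positivity)] at hL
  -- `c log ≤ c η/(2(c+1)) (L²+1) ≤ η/2 (L²+1) ≤ η L²`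
  have h1 : c * Real.log ((L : ℝ) ^ 2 + 1) ≤ c * (η / (2 * (c + 1)) * ((L : ℝ) ^ 2 + 1)) :=
    mul_le_mul_of_nonneg_left hL hc
  have h2' : c * (η / (2 * (c + 1))) ≤ η / 2 := by
    have hc1 : (c + 1) ≠ 0 := by positivity
    calc c * (η / (2 * (c + 1))) = c * η / ((c + 1) * 2) := by ring
      _ ≤ (c + 1) * η / ((c + 1) * 2) := div_le_div_of_nonneg_right (by nlinarith) (by positivity)
      _ = η / 2 := mul_div_mul_left η 2 hc1
  have h3' : c * (η / (2 * (c + 1)) * ((L : ℝ) ^ 2 + 1)) ≤ η / 2 * ((L : ℝ) ^ 2 + 1) := by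
    rw [← mul_assoc]; exact mul_le_mul_of_nonneg_right h2' (by positivity)
  nlinarith [h1, h3', hL1', hη]

/-- The final bookkeeping of the uniformity lemma, pure linear arithmetic. [folklore] -/
private theorem gcz_assembly_arith {Z₁ Z₂ A B κ m δ' lg ε P BXY S BM L2 : ℝ}
    (hZab : Z₁ ≤ Z₂ + A + B + κ * (2 * (δ' * L2 + 1)))
    (hent : A + B ≤ ε / 8 * L2 + ε / 8 * L2 + 4 * lg)
    (hnet : Z₂ ≤ (P + ε / 8) * L2)
    (hμ : BM ≤ BXY * L2 + m * (2 * (δ' * L2 + 1) + 2))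
    (hv1 : 8 * lg ≤ ε / 8 * L2) (hv2 : (κ + m + 1) * 4 ≤ ε / 8 * L2)
    (hS : (P + BXY) * L2 ≤ S * L2) (he1 : (κ + m + 1) * (2 * δ') * L2 ≤ ε / 8 * L2)
    (hκ : 0 ≤ κ) (hm : 0 ≤ m) (hδL : 0 ≤ δ' * L2) :
    BM + Z₁ ≤ (S + ε) * L2 := by
  have h1 : κ * (2 * (δ' * L2 + 1)) ≤ (κ + m + 1) * (2 * δ') * L2 + 2 * κ := by nlinarith
  have h2 : m * (2 * (δ' * L2 + 1) + 2) ≤ (κ + m + 1) * (2 * δ') * L2 + 4 * m := by nlinarith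
  nlinarith

section GCZ

variable {β : ℝ} (hβ : 0 ≤ β) (t t' : ℝ) {U : ℝ} (hU : 0 ≤ U) (μ hz : ℝ)
include hβ hU

/-- The Legendre set is bounded above (a-priori ceiling of `p(x,y)` plus `2|βμ|`). [cite: Ruelle1969, §3.4] -/
theorem bddAbove_legendreSetZeeman :
    BddAbove ((fun z : ℝ × ℝ => pressureTT'₂ β t t' U z.1 z.2 + (β * μ * (z.1 + z.2) + β * hz * (z.1 - z.2))) ''
      (Set.Ico (0 : ℝ) 1 ×ˢ Set.Ico (0 : ℝ) 1)) := by
  refine ⟨Real.log 4 + β * (8 * |t| + 8 * |t'|) + Real.log 2 + β * (4 * |t| + 4 * |t'| + U) + 2 * (|β * μ| + |β * hz|), ?_⟩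
  rintro _ ⟨⟨x, y⟩, ⟨hx, hy⟩, rfl⟩
  have h1 := pressureTT'₂_le_apriori hβ t t' hU hx.1 hx.2 hy.1 hy.2
  have h2 : (β * μ * (x + y) + β * hz * (x - y)) ≤ 2 * (|β * μ| + |β * hz|) := by
    have hxy : |x + y| ≤ 2 := by rw [abs_le]; constructor <;> linarith [hx.1, hx.2, hy.1, hy.2]
    have hxy' : |x - y| ≤ 2 := by rw [abs_le]; constructor <;> linarith [hx.1, hx.2, hy.1, hy.2]
    have e1 : β * μ * (x + y) ≤ |β * μ| * 2 :=
      (le_abs_self _).trans (by rw [abs_mul]; exact mul_le_mul_of_nonneg_left hxy (abs_nonneg _))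
    have e2 : β * hz * (x - y) ≤ |β * hz| * 2 :=
      (le_abs_self _).trans (by rw [abs_mul]; exact mul_le_mul_of_nonneg_left hxy' (abs_nonneg _))
    linarith
  simp only
  linarith

/-- **Every spin sector is below the Legendre supremum**: `p(x,y) + βμ(x+y) ≤ P(μ)` for `x, y ∈ [0,1)`.
[cite: Ruelle1969, §3.4] -/
theorem pressureTT'₂_add_le_gcPressureTT'Zeeman {x y : ℝ} (hx0 : 0 ≤ x) (hx1 : x < 1) (hy0 : 0 ≤ y) (hy1 : y < 1) :
    pressureTT'₂ β t t' U x y + (β * μ * (x + y) + β * hz * (x - y)) ≤ gcPressureTT'Zeeman β t t' U μ hz :=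
  le_csSup (bddAbove_legendreSetZeeman hβ t t' hU μ hz) ⟨(x, y), ⟨⟨hx0, hx1⟩, ⟨hy0, hy1⟩⟩, rfl⟩

/-- `P(μ) ≤ q` iff every sector term is `≤ q`. [cite: Ruelle1969, §3.4] -/
theorem gcPressureTT'Zeeman_le_iff {q : ℝ} :
    gcPressureTT'Zeeman β t t' U μ hz ≤ q ↔
      ∀ x y : ℝ, 0 ≤ x → x < 1 → 0 ≤ y → y < 1 → pressureTT'₂ β t t' U x y + (β * μ * (x + y) + β * hz * (x - y)) ≤ q := by
  have hne : ((fun z : ℝ × ℝ => pressureTT'₂ β t t' U z.1 z.2 + (β * μ * (z.1 + z.2) + β * hz * (z.1 - z.2))) ''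
      (Set.Ico (0 : ℝ) 1 ×ˢ Set.Ico (0 : ℝ) 1)).Nonempty :=
    ⟨_, ⟨(0, 0), ⟨⟨le_rfl, one_pos⟩, ⟨le_rfl, one_pos⟩⟩, rfl⟩⟩
  rw [gcPressureTT'Zeeman, csSup_le_iff (bddAbove_legendreSetZeeman hβ t t' hU μ hz) hne]
  constructor
  · intro h x y hx0 hx1 hy0 hy1
    exact h _ ⟨(x, y), ⟨⟨hx0, hx1⟩, ⟨hy0, hy1⟩⟩, rfl⟩
  · rintro h _ ⟨⟨x, y⟩, ⟨hx, hy⟩, rfl⟩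
    exact h x y hx.1 hx.2 hy.1 hy.2

/-- **The canonical number of record is below the Legendre supremum**: `pressureTT' β t t' U n + βμn ≤ P(μ)`
(`0 ≤ n < 2`; the diagonal sector `x = y = n/2`). [cite: Ruelle1969, §3.4] -/
theorem pressureTT'_add_le_gcPressureTT'Zeeman {n : ℝ} (hn0 : 0 ≤ n) (hn2 : n < 2) :
    pressureTT' β t t' U n + β * μ * n ≤ gcPressureTT'Zeeman β t t' U μ hz := by
  have h := pressureTT'₂_add_le_gcPressureTT'Zeeman hβ t t' hU μ hz (x := n / 2) (y := n / 2) (by linarith) (by linarith)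
    (by linarith) (by linarith)
  rw [pressureTT'₂_half_half hβ t t' hU hn0 hn2] at h
  have e : β * μ * (n / 2 + n / 2) + β * hz * (n / 2 - n / 2) = β * μ * n := by ring
  rw [e] at h
  exact h
set_option maxHeartbeats 400000 in
/-- **Uniformity of the canonical limit over the spin sectors.** For every `ε > 0`, eventually in `L`: for ALL
`a, b ≤ L²`, `βμ(a+b)/L² + L⁻² log Z_L(a,b) ≤ sup_{x,y ∈ [0,1)} [p(x,y) + βμ(x+y)] + ε`. [cite: Ruelle1969, §3.4] -/
theorem eventually_forall_sector_le_sSup_zeeman {ε : ℝ} (hε : 0 < ε) :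
    ∀ᶠ L : ℕ in atTop, ∀ a b : ℕ, a ≤ L * L → b ≤ L * L →
      ((β * μ * (a + b) + β * hz * (a - b)) + Real.log (partitionFn β (spinSectorHamiltonian a b
        (hubbardRectTorusTT' L L t t' U))).re) / (L : ℝ) ^ 2 ≤ gcPressureTT'Zeeman β t t' U μ hz + ε := by
  -- constants
  set κ : ℝ := β * (4 * |t| + 4 * |t'| + U) with hκ
  have hκ0 : 0 ≤ κ := by rw [hκ]; positivity
  set S := gcPressureTT'Zeeman β t t' U μ hz with hS
  -- uniform continuity of the binary entropy on `[0,1]`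
  have huc : UniformContinuousOn Real.binEntropy (Set.Icc (0 : ℝ) 1) :=
    isCompact_Icc.uniformContinuousOn_of_continuous Real.binEntropy_continuous.continuousOn
  obtain ⟨δ₁, hδ₁, hδ⟩ := Metric.uniformContinuousOn_iff.1 huc (ε / 8) (by positivity)
  -- the net scale `δ' = 1/(N+1) ≤ min(δ₁/2, ε/(8(κ+|βμ|+1)))`
  obtain ⟨N, hN⟩ := exists_nat_gt (max (2 / δ₁) (16 * (κ + (|β * μ| + |β * hz|) + 1) / ε))
  have hNpos : (0 : ℝ) < (N : ℝ) + 1 := by positivity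
  set δ' : ℝ := 1 / ((N : ℝ) + 1) with hδ'
  have hδ'pos : 0 < δ' := by rw [hδ']; positivity
  have hδ'1 : δ' ≤ δ₁ / 2 := by
    have h1 : 2 / δ₁ < (N : ℝ) + 1 := by linarith [le_max_left (2 / δ₁) (16 * (κ + (|β * μ| + |β * hz|) + 1) / ε)]
    rw [hδ', div_le_iff₀ hNpos]
    rw [div_lt_iff₀ hδ₁] at h1
    linarith
  have hδ'2 : (κ + (|β * μ| + |β * hz|) + 1) * (2 * δ') ≤ ε / 8 := by
    have h1 : 16 * (κ + (|β * μ| + |β * hz|) + 1) / ε < (N : ℝ) + 1 := by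
      linarith [le_max_right (2 / δ₁) (16 * (κ + (|β * μ| + |β * hz|) + 1) / ε)]
    rw [div_lt_iff₀ hε] at h1
    rw [hδ']
    have : (κ + (|β * μ| + |β * hz|) + 1) * (2 * (1 / ((N : ℝ) + 1))) = 2 * (κ + (|β * μ| + |β * hz|) + 1) / ((N : ℝ) + 1) := by ring
    rw [this, div_le_iff₀ hNpos]
    linarith
  -- the net points `u_i = i δ'`, `i ≤ N`, lie in `[0, 1)`
  have hu0 : ∀ i : Fin (N + 1), 0 ≤ ((i : ℕ) : ℝ) * δ' := fun i => by positivity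
  have hu1 : ∀ i : Fin (N + 1), ((i : ℕ) : ℝ) * δ' < 1 := fun i => by
    have : ((i : ℕ) : ℝ) ≤ N := by exact_mod_cast Nat.lt_succ_iff.1 i.isLt
    rw [hδ', mul_one_div, div_lt_one hNpos]; linarith
  -- pointwise convergence at the net points, all at once
  have hpt : ∀ᶠ L : ℕ in atTop, ∀ ij : Fin (N + 1) × Fin (N + 1),
      spinSectorPressureTT' β t t' U (((ij.1 : ℕ) : ℝ) * δ') (((ij.2 : ℕ) : ℝ) * δ') L ≤
        pressureTT'₂ β t t' U (((ij.1 : ℕ) : ℝ) * δ') (((ij.2 : ℕ) : ℝ) * δ') + ε / 8 := by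
    refine eventually_all.2 fun ij => ?_
    have h := tendsto_spinSectorPressureTT' hβ t t' hU (hu0 ij.1) (hu1 ij.1) (hu0 ij.2) (hu1 ij.2)
    exact h.eventually (Iic_mem_nhds (by linarith))
  -- the volume thresholds
  have hvol1 : ∀ᶠ L : ℕ in atTop, 8 * Real.log ((L : ℝ) ^ 2 + 1) ≤ ε / 8 * (L : ℝ) ^ 2 :=
    eventually_mul_log_sq_add_one_le (by norm_num) (by positivity)
  have hvol2 : ∀ᶠ L : ℕ in atTop, (κ + (|β * μ| + |β * hz|) + 1) * 4 ≤ ε / 8 * (L : ℝ) ^ 2 ∧ 2 ≤ δ₁ / 2 * (L : ℝ) ^ 2 := by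
    have h2 : Tendsto (fun L : ℕ => (L : ℝ) ^ 2) atTop atTop :=
      (tendsto_pow_atTop two_ne_zero).comp tendsto_natCast_atTop_atTop
    filter_upwards [h2.eventually_ge_atTop (max ((κ + (|β * μ| + |β * hz|) + 1) * 4 / (ε / 8)) (2 / (δ₁ / 2)))] with L hL
    constructor
    · have h := (div_le_iff₀ (by positivity : (0 : ℝ) < ε / 8)).1 ((le_max_left _ _).trans hL)
      linarith
    · have h := (div_le_iff₀ (by positivity : (0 : ℝ) < δ₁ / 2)).1 ((le_max_right _ _).trans hL)
      linarith
  filter_upwards [hpt, hvol1, hvol2, eventually_ge_atTop 1] with L hptL hv1 ⟨hv2, hv3⟩ hL1 a b ha hb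
  -- notation at volume `L`
  have hL2 : (0 : ℝ) < (L : ℝ) ^ 2 := by
    have : (1 : ℝ) ≤ L := by exact_mod_cast hL1
    positivity
  have hMM : ((L * L : ℕ) : ℝ) = (L : ℝ) ^ 2 := by push_cast; ring
  have hMpos : 0 < L * L := Nat.mul_pos hL1 hL1
  set M : ℕ := L * L with hMdef
  -- densities of the given sector and their net points
  have hua : 0 ≤ (a : ℝ) / (L : ℝ) ^ 2 ∧ (a : ℝ) / (L : ℝ) ^ 2 ≤ 1 := by
    constructor
    · positivity
    · rw [div_le_one hL2, ← hMM]; exact_mod_cast ha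
  have hub : 0 ≤ (b : ℝ) / (L : ℝ) ^ 2 ∧ (b : ℝ) / (L : ℝ) ^ 2 ≤ 1 := by
    constructor
    · positivity
    · rw [div_le_one hL2, ← hMM]; exact_mod_cast hb
  obtain ⟨i, hi⟩ := exists_net_point N hua.1 hua.2
  obtain ⟨j, hj⟩ := exists_net_point N hub.1 hub.2
  have ei : ((i : ℕ) : ℝ) / ((N : ℝ) + 1) = ((i : ℕ) : ℝ) * δ' := by rw [hδ']; ring
  have ej : ((j : ℕ) : ℝ) / ((N : ℝ) + 1) = ((j : ℕ) : ℝ) * δ' := by rw [hδ']; ring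
  rw [ei] at hi
  rw [ej] at hj
  set xi : ℝ := ((i : ℕ) : ℝ) * δ' with hxi
  set yj : ℝ := ((j : ℕ) : ℝ) * δ' with hyj
  set a' : ℕ := halfRectN (2 * xi) L with ha'def
  set b' : ℕ := halfRectN (2 * yj) L with hb'def
  have ha'M : a' < L * L := halfRectN_lt_sq (by linarith [hu0 i]) (by linarith [hu1 i]) hL1
  have hb'M : b' < L * L := halfRectN_lt_sq (by linarith [hu0 j]) (by linarith [hu1 j]) hL1
  -- `|a' − xi L²| ≤ 1`, `|b' − yj L²| ≤ 1`
  have ha'1 : (a' : ℝ) ≤ xi * (L : ℝ) ^ 2 ∧ xi * (L : ℝ) ^ 2 - 1 < a' := by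
    have h1 := halfRectN_le_half_mul_sq' (2 * xi) (by linarith [hu0 i]) L
    have h2 := half_mul_sq_sub_one_lt_halfRectN' (2 * xi) L
    constructor <;> [linarith; linarith]
  have hb'1 : (b' : ℝ) ≤ yj * (L : ℝ) ^ 2 ∧ yj * (L : ℝ) ^ 2 - 1 < b' := by
    have h1 := halfRectN_le_half_mul_sq' (2 * yj) (by linarith [hu0 j]) L
    have h2 := half_mul_sq_sub_one_lt_halfRectN' (2 * yj) L
    constructor <;> [linarith; linarith]
  -- distances `|a − a'| ≤ δ' L² + 1`
  have hdista : |((a' : ℝ)) - a| ≤ δ' * (L : ℝ) ^ 2 + 1 := by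
    have h1 : |(a : ℝ) - xi * (L : ℝ) ^ 2| ≤ δ' * (L : ℝ) ^ 2 := by
      have e : (a : ℝ) - xi * (L : ℝ) ^ 2 = ((a : ℝ) / (L : ℝ) ^ 2 - xi) * (L : ℝ) ^ 2 := by field_simp
      rw [e, abs_mul, abs_of_pos hL2]
      exact mul_le_mul_of_nonneg_right (by rwa [hδ']) hL2.le
    have h2 : |(a' : ℝ) - xi * (L : ℝ) ^ 2| ≤ 1 := by rw [abs_le]; constructor <;> linarith [ha'1.1, ha'1.2]
    calc |((a' : ℝ)) - a| = |((a' : ℝ) - xi * (L : ℝ) ^ 2) - ((a : ℝ) - xi * (L : ℝ) ^ 2)| := by ring_nf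
      _ ≤ |(a' : ℝ) - xi * (L : ℝ) ^ 2| + |(a : ℝ) - xi * (L : ℝ) ^ 2| := abs_sub _ _
      _ ≤ 1 + δ' * (L : ℝ) ^ 2 := add_le_add h2 h1
      _ = δ' * (L : ℝ) ^ 2 + 1 := by ring
  have hdistb : |((b' : ℝ)) - b| ≤ δ' * (L : ℝ) ^ 2 + 1 := by
    have h1 : |(b : ℝ) - yj * (L : ℝ) ^ 2| ≤ δ' * (L : ℝ) ^ 2 := by
      have e : (b : ℝ) - yj * (L : ℝ) ^ 2 = ((b : ℝ) / (L : ℝ) ^ 2 - yj) * (L : ℝ) ^ 2 := by field_simp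
      rw [e, abs_mul, abs_of_pos hL2]
      exact mul_le_mul_of_nonneg_right (by rwa [hδ']) hL2.le
    have h2 : |(b' : ℝ) - yj * (L : ℝ) ^ 2| ≤ 1 := by rw [abs_le]; constructor <;> linarith [hb'1.1, hb'1.2]
    calc |((b' : ℝ)) - b| = |((b' : ℝ) - yj * (L : ℝ) ^ 2) - ((b : ℝ) - yj * (L : ℝ) ^ 2)| := by ring_nf
      _ ≤ |(b' : ℝ) - yj * (L : ℝ) ^ 2| + |(b : ℝ) - yj * (L : ℝ) ^ 2| := abs_sub _ _
      _ ≤ 1 + δ' * (L : ℝ) ^ 2 := add_le_add h2 h1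
      _ = δ' * (L : ℝ) ^ 2 + 1 := by ring
  -- (1) the interaction free entropy is `κ`-Lipschitz: from `(a,b)` to `(a',b')`
  have hF1 := abs_interactionEntropy_sub_le_fst hβ t t' hU L (a := a') (a' := a) (b := b) ha'M.le ha hb
  have hF2 := abs_interactionEntropy_sub_le_snd hβ t t' hU L (a := a') (b := b') (b' := b) ha'M.le hb'M.le hb
  -- (2) the binomial entropies against `H_b`
  obtain ⟨hCa1, hCa2⟩ := log_choose_mem_binEntropy hMpos ha
  obtain ⟨hCa'1, hCa'2⟩ := log_choose_mem_binEntropy hMpos ha'M.le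
  obtain ⟨hCb1, hCb2⟩ := log_choose_mem_binEntropy hMpos hb
  obtain ⟨hCb'1, hCb'2⟩ := log_choose_mem_binEntropy hMpos hb'M.le
  -- (3) uniform continuity of `H_b`: the densities of `a` and `a'` are `δ₁`-close
  have hMreal : ((M : ℕ) : ℝ) = (L : ℝ) ^ 2 := by rw [hMdef]; exact hMM
  have hclose : ∀ {c c' : ℕ}, c ≤ L * L → c' ≤ L * L → |((c' : ℝ)) - c| ≤ δ' * (L : ℝ) ^ 2 + 1 →
      |Real.binEntropy ((c : ℝ) / M) - Real.binEntropy ((c' : ℝ) / M)| < ε / 8 := by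
    intro c c' hc hc' hcc'
    have hcI : (c : ℝ) / M ∈ Set.Icc (0 : ℝ) 1 :=
      ⟨by positivity, by rw [hMreal, div_le_one hL2, ← hMM]; exact_mod_cast hc⟩
    have hc'I : (c' : ℝ) / M ∈ Set.Icc (0 : ℝ) 1 :=
      ⟨by positivity, by rw [hMreal, div_le_one hL2, ← hMM]; exact_mod_cast hc'⟩
    have hd : dist ((c : ℝ) / M) ((c' : ℝ) / M) < δ₁ := by
      rw [Real.dist_eq, hMreal, ← sub_div, abs_div, abs_of_pos hL2, div_lt_iff₀ hL2, abs_sub_comm]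
      have h1 : δ' * (L : ℝ) ^ 2 ≤ δ₁ / 2 * (L : ℝ) ^ 2 := mul_le_mul_of_nonneg_right hδ'1 hL2.le
      calc |((c' : ℝ)) - c| ≤ δ' * (L : ℝ) ^ 2 + 1 := hcc'
        _ < δ₁ / 2 * (L : ℝ) ^ 2 + δ₁ / 2 * (L : ℝ) ^ 2 := by linarith
        _ = δ₁ * (L : ℝ) ^ 2 := by ring
    have := hδ _ hcI _ hc'I hd
    rwa [Real.dist_eq] at this
  have hHa := hclose ha ha'M.le hdista
  have hHb := hclose hb hb'M.le hdistb
  rw [abs_lt] at hHa hHb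
  -- (4) the pointwise bound at the net point `(xi, yj)`
  have hnet := hptL (i, j)
  simp only at hnet
  have hnet' : Real.log (partitionFn β (spinSectorHamiltonian a' b' (hubbardRectTorusTT' L L t t' U))).re ≤
      (pressureTT'₂ β t t' U xi yj + ε / 8) * (L : ℝ) ^ 2 := by
    have h := hnet
    rw [spinSectorPressureTT', div_le_iff₀ hL2] at h
    exact h
  -- (5) the Legendre supremum at the net point
  have hsup := pressureTT'₂_add_le_gcPressureTT'Zeeman hβ t t' hU μ hz (hu0 i) (hu1 i) (hu0 j) (hu1 j)
  -- (6) the linear term: `ℓ(a,b) ≤ ℓ(xi,yj)L² + (|βμ|+|βh|)(2δ'L² + 4)`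
  have hμ : (β * μ * ((a : ℝ) + b) + β * hz * ((a : ℝ) - b)) ≤
      (β * μ * (xi + yj) + β * hz * (xi - yj)) * (L : ℝ) ^ 2 + (|β * μ| + |β * hz|) * (2 * (δ' * (L : ℝ) ^ 2 + 1) + 2) := by
    have h2 : |(a' : ℝ) - xi * (L : ℝ) ^ 2| ≤ 1 := by rw [abs_le]; constructor <;> linarith [ha'1.1, ha'1.2]
    have h3 : |(b' : ℝ) - yj * (L : ℝ) ^ 2| ≤ 1 := by rw [abs_le]; constructor <;> linarith [hb'1.1, hb'1.2]
    have h4 : |((a : ℝ)) - a'| ≤ δ' * (L : ℝ) ^ 2 + 1 := by rw [abs_sub_comm]; exact hdista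
    have h5 : |((b : ℝ)) - b'| ≤ δ' * (L : ℝ) ^ 2 + 1 := by rw [abs_sub_comm]; exact hdistb
    have hA : |(a : ℝ) - xi * (L : ℝ) ^ 2| ≤ δ' * (L : ℝ) ^ 2 + 2 := by
      calc |(a : ℝ) - xi * (L : ℝ) ^ 2| = |(((a : ℝ)) - a') + (((a' : ℝ)) - xi * (L : ℝ) ^ 2)| := by ring_nf
        _ ≤ |((a : ℝ)) - a'| + |((a' : ℝ)) - xi * (L : ℝ) ^ 2| := abs_add_le _ _
        _ ≤ _ := by linarith
    have hB : |(b : ℝ) - yj * (L : ℝ) ^ 2| ≤ δ' * (L : ℝ) ^ 2 + 2 := by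
      calc |(b : ℝ) - yj * (L : ℝ) ^ 2| = |(((b : ℝ)) - b') + (((b' : ℝ)) - yj * (L : ℝ) ^ 2)| := by ring_nf
        _ ≤ |((b : ℝ)) - b'| + |((b' : ℝ)) - yj * (L : ℝ) ^ 2| := abs_add_le _ _
        _ ≤ _ := by linarith
    -- `ℓ(a,b) − ℓ(xi,yj)L² = (βμ+βh)(a − xiL²) + (βμ−βh)(b − yjL²)`
    have e : (β * μ * ((a : ℝ) + b) + β * hz * ((a : ℝ) - b)) - (β * μ * (xi + yj) + β * hz * (xi - yj)) * (L : ℝ) ^ 2 =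
        (β * μ + β * hz) * ((a : ℝ) - xi * (L : ℝ) ^ 2) + (β * μ - β * hz) * ((b : ℝ) - yj * (L : ℝ) ^ 2) := by ring
    have hc1 : |β * μ + β * hz| ≤ |β * μ| + |β * hz| := abs_add_le _ _
    have hc2 : |β * μ - β * hz| ≤ |β * μ| + |β * hz| := abs_sub _ _
    have i1 : (β * μ + β * hz) * ((a : ℝ) - xi * (L : ℝ) ^ 2) ≤ (|β * μ| + |β * hz|) * (δ' * (L : ℝ) ^ 2 + 2) :=
      (le_abs_self _).trans (by
        rw [abs_mul]; exact mul_le_mul hc1 hA (abs_nonneg _) (by positivity))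
    have i2 : (β * μ - β * hz) * ((b : ℝ) - yj * (L : ℝ) ^ 2) ≤ (|β * μ| + |β * hz|) * (δ' * (L : ℝ) ^ 2 + 2) :=
      (le_abs_self _).trans (by
        rw [abs_mul]; exact mul_le_mul hc2 hB (abs_nonneg _) (by positivity))
    have e2 : (|β * μ| + |β * hz|) * (δ' * (L : ℝ) ^ 2 + 2) + (|β * μ| + |β * hz|) * (δ' * (L : ℝ) ^ 2 + 2) =
        (|β * μ| + |β * hz|) * (2 * (δ' * (L : ℝ) ^ 2 + 1) + 2) := by ring
    linarith
  -- (7) assemble: everything over `L²`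
  rw [div_le_iff₀ hL2]
  have hZab : Real.log (partitionFn β (spinSectorHamiltonian a b (hubbardRectTorusTT' L L t t' U))).re ≤
      Real.log (partitionFn β (spinSectorHamiltonian a' b' (hubbardRectTorusTT' L L t t' U))).re +
        (Real.log (M.choose a) - Real.log (M.choose a')) +
        (Real.log (M.choose b) - Real.log (M.choose b')) + κ * (2 * (δ' * (L : ℝ) ^ 2 + 1)) := by
    rw [abs_le] at hF1 hF2
    have h1 : κ * |((a : ℝ)) - a'| ≤ κ * (δ' * (L : ℝ) ^ 2 + 1) := by
      rw [abs_sub_comm]; exact mul_le_mul_of_nonneg_left hdista hκ0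
    have h2 : κ * |((b : ℝ)) - b'| ≤ κ * (δ' * (L : ℝ) ^ 2 + 1) := by
      rw [abs_sub_comm]; exact mul_le_mul_of_nonneg_left hdistb hκ0
    linarith [hF1.1, hF1.2, hF2.1, hF2.2]
  have hent : (Real.log (M.choose a) - Real.log (M.choose a')) + (Real.log (M.choose b) - Real.log (M.choose b')) ≤
      ε / 8 * (L : ℝ) ^ 2 + ε / 8 * (L : ℝ) ^ 2 + 4 * Real.log ((L : ℝ) ^ 2 + 1) := by
    rw [hMreal] at hCa1 hCa2 hCa'1 hCa'2 hCb1 hCb2 hCb'1 hCb'2 hHa hHb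
    have e1 := mul_le_mul_of_nonneg_left hHa.2.le hL2.le
    have e2 := mul_le_mul_of_nonneg_left hHb.2.le hL2.le
    linarith [hCa2, hCa'1, hCb2, hCb'1, e1, e2]
  -- make the two partition functions opaque atoms for the final arithmetic
  generalize Real.log (partitionFn β (spinSectorHamiltonian a b (hubbardRectTorusTT' L L t t' U))).re = Z₁ at hZab ⊢
  generalize Real.log (partitionFn β (spinSectorHamiltonian a' b' (hubbardRectTorusTT' L L t t' U))).re = Z₂ at hZab hnet'
  have e1 : (κ + (|β * μ| + |β * hz|) + 1) * (2 * δ') * (L : ℝ) ^ 2 ≤ ε / 8 * (L : ℝ) ^ 2 :=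
    mul_le_mul_of_nonneg_right hδ'2 hL2.le
  have hS' : (pressureTT'₂ β t t' U xi yj + (β * μ * (xi + yj) + β * hz * (xi - yj))) * (L : ℝ) ^ 2 ≤ S * (L : ℝ) ^ 2 :=
    mul_le_mul_of_nonneg_right hsup hL2.le
  have hδL : 0 ≤ δ' * (L : ℝ) ^ 2 := by positivity
  have hm0 : 0 ≤ |β * μ| + |β * hz| := add_nonneg (abs_nonneg _) (abs_nonneg _)
  exact gcz_assembly_arith hZab hent hnet' hμ hv1 hv2 hS' e1 hκ0 hm0 hδL

/-! ### §3 The grand-canonical pressure exists and is the Legendre transform -/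

/-- **Existence and Legendre form of the grand-canonical pressure**:
`L⁻² log Re Z_β(hubbardRectTorusTT' L L t t' U − μN) → P(β; t,t',U; μ) = sup_{x,y ∈ [0,1)} [p(x,y) + βμ(x+y)]`
(`β ≥ 0`, `U ≥ 0`, every real `μ`). [cite: Ruelle1969, §3.4] [cite: Israel1979, Thm. I.2.4] -/
theorem tendsto_torusGCPressureTT'Zeeman :
    Tendsto (fun L : ℕ => torusGCPressureTT'Zeeman β t t' U μ hz L) atTop (𝓝 (gcPressureTT'Zeeman β t t' U μ hz)) := by
  set S := gcPressureTT'Zeeman β t t' U μ hz with hS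
  have hH : ∀ L : ℕ, (hubbardRectTorusTT' L L t t' U).IsHermitian := fun L => hubbardRectTorusTT'_isHermitian L L t t' U
  have hP : ∀ L : ℕ, PreservesSectors (hubbardRectTorusTT' L L t t' U) := fun L => by
    unfold hubbardRectTorusTT'
    exact (preservesSectors_hamiltonian _ t U).add (preservesSectors_hamiltonian _ t' 0)
  rw [Metric.tendsto_atTop]
  intro ε hε
  -- lower bound: `S − ε/2 < p(x,y) + βμ(x+y)` for some sector, then its pointwise convergence
  have hne : ((fun z : ℝ × ℝ => pressureTT'₂ β t t' U z.1 z.2 + (β * μ * (z.1 + z.2) + β * hz * (z.1 - z.2))) ''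
      (Set.Ico (0 : ℝ) 1 ×ˢ Set.Ico (0 : ℝ) 1)).Nonempty :=
    ⟨_, ⟨(0, 0), ⟨⟨le_rfl, one_pos⟩, ⟨le_rfl, one_pos⟩⟩, rfl⟩⟩
  obtain ⟨_, ⟨⟨x, y⟩, ⟨hx, hy⟩, rfl⟩, hlt⟩ := exists_lt_of_lt_csSup hne (by linarith : S - ε / 2 < S)
  simp only at hlt
  have hlow : ∀ᶠ L : ℕ in atTop, S - ε < torusGCPressureTT'Zeeman β t t' U μ hz L := by
    have hconv := tendsto_spinSectorPressureTT' hβ t t' hU hx.1 hx.2 hy.1 hy.2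
    have hk : Tendsto (fun L : ℕ => β * μ * (((halfRectN (2 * x) L : ℝ) + halfRectN (2 * y) L) / (L : ℝ) ^ 2) +
        β * hz * (((halfRectN (2 * x) L : ℝ) - halfRectN (2 * y) L) / (L : ℝ) ^ 2))
        atTop (𝓝 (β * μ * (x + y) + β * hz * (x - y))) := by
      have hX := tendsto_halfRectN_div_sq₄ (n := 2 * x) (by linarith [hx.1])
      have hY := tendsto_halfRectN_div_sq₄ (n := 2 * y) (by linarith [hy.1])
      have h := ((hX.add hY).const_mul (β * μ)).add ((hX.sub hY).const_mul (β * hz))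
      rw [show 2 * x / 2 + 2 * y / 2 = x + y by ring, show 2 * x / 2 - 2 * y / 2 = x - y by ring] at h
      refine h.congr fun L => ?_
      rw [add_div, sub_div]
    have hsum := hconv.add hk
    have hev := hsum.eventually (Ioi_mem_nhds (by linarith : S - ε < pressureTT'₂ β t t' U x y + (β * μ * (x + y) + β * hz * (x - y))))
    filter_upwards [hev, eventually_ge_atTop 1] with L hL hL1
    have hL2 : (0 : ℝ) < (L : ℝ) ^ 2 := by
      have : (1 : ℝ) ≤ L := by exact_mod_cast hL1
      positivity
    haveI : Nonempty (Subtype (spinConfig (Λ := Fin L ×ₗ Fin L) (halfRectN (2 * x) L) (halfRectN (2 * y) L))) :=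
      nonempty_spinConfig (by rw [card_rectSites]; exact (halfRectN_lt_sq (by linarith [hx.1]) (by linarith [hx.2]) hL1).le)
        (by rw [card_rectSites]; exact (halfRectN_lt_sq (by linarith [hy.1]) (by linarith [hy.2]) hL1).le)
    have hgc := log_partitionFn_spinSector_le_grandCanonicalZeeman (hH L) (hP L) β μ hz
      (a := halfRectN (2 * x) L) (b := halfRectN (2 * y) L)
    rw [torusGCPressureTT'Zeeman, lt_div_iff₀ hL2]
    rw [spinSectorPressureTT', ← mul_div_assoc, ← mul_div_assoc, ← add_div, ← add_div, lt_div_iff₀ hL2] at hL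
    linarith
  -- upper bound from the uniformity lemma
  have hup : ∀ᶠ L : ℕ in atTop, torusGCPressureTT'Zeeman β t t' U μ hz L < S + ε := by
    have hunif := eventually_forall_sector_le_sSup_zeeman hβ t t' hU μ hz (ε := ε / 4) (by positivity)
    have hvol : ∀ᶠ L : ℕ in atTop, 2 * Real.log ((L : ℝ) ^ 2 + 1) ≤ ε / 4 * (L : ℝ) ^ 2 :=
      eventually_mul_log_sq_add_one_le (by norm_num) (by positivity)
    filter_upwards [hunif, hvol, eventually_ge_atTop 1] with L hL hv hL1
    have hL2 : (0 : ℝ) < (L : ℝ) ^ 2 := by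
      have : (1 : ℝ) ≤ L := by exact_mod_cast hL1
      positivity
    have hMM : ((L * L : ℕ) : ℝ) = (L : ℝ) ^ 2 := by push_cast; ring
    have hB : ∀ a b : ℕ, a ≤ Fintype.card (Fin L ×ₗ Fin L) → b ≤ Fintype.card (Fin L ×ₗ Fin L) →
        Real.exp ((β * μ * (a + b) + β * hz * (a - b))) * (partitionFn β (spinSectorHamiltonian a b (hubbardRectTorusTT' L L t t' U))).re ≤
          Real.exp ((S + ε / 4) * (L : ℝ) ^ 2) := by
      intro a b ha hb
      rw [card_rectSites] at ha hb
      haveI : Nonempty (Subtype (spinConfig (Λ := Fin L ×ₗ Fin L) a b)) :=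
        nonempty_spinConfig (by rw [card_rectSites]; exact ha) (by rw [card_rectSites]; exact hb)
      have hZpos : 0 < (partitionFn β (spinSectorHamiltonian a b (hubbardRectTorusTT' L L t t' U))).re :=
        partitionFn_spinSector_re_pos (hH L) β
      have h := hL a b ha hb
      rw [div_le_iff₀ hL2] at h
      calc _ = Real.exp ((β * μ * (a + b) + β * hz * (a - b)) + Real.log (partitionFn β (spinSectorHamiltonian a b
            (hubbardRectTorusTT' L L t t' U))).re) := by rw [Real.exp_add _ (Real.log _), Real.exp_log hZpos]
        _ ≤ _ := Real.exp_le_exp.2 h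
    have h := log_partitionFn_grandCanonicalZeeman_le_of_forall (hH L) (hP L) β μ hz hB
    rw [card_rectSites, hMM] at h
    rw [torusGCPressureTT'Zeeman, div_lt_iff₀ hL2]
    have hpos : 0 < ε / 2 * (L : ℝ) ^ 2 := by positivity
    linarith
  obtain ⟨N, hN⟩ := eventually_atTop.1 (hlow.and hup)
  refine ⟨N, fun L hL => ?_⟩
  obtain ⟨h1, h2⟩ := hN L hL
  rw [Real.dist_eq, abs_lt]
  constructor <;> linarith

/-- The limit along every side sequence `Ls → ∞` (the form the certificate readers use). [cite: Ruelle1969, §3.4] -/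
theorem tendsto_torusGCPressureTT'Zeeman_comp {Ls : ℕ → ℕ} (hLs : Tendsto Ls atTop atTop) :
    Tendsto (fun j : ℕ => Real.log (partitionFn β (hubbardRectTorusTT' (Ls j) (Ls j) t t' U -
      (μ : ℂ) • totalNumber - (hz : ℂ) • spinImbalance)).re / ((Ls j : ℕ) : ℝ) ^ 2) atTop
      (𝓝 (gcPressureTT'Zeeman β t t' U μ hz)) :=
  (tendsto_torusGCPressureTT'Zeeman hβ t t' hU μ hz).comp hLs

/-- **Grand-canonical CEILINGS are bounds on the number**: if along some `Ls → ∞`, for every `ε > 0` eventually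
`log Re Z_β(H_L − μN) ≤ (q + ε) L²`, then `P(μ) ≤ q` — hence `p(x,y) + βμ(x+y) ≤ q` for every sector and
`pressureTT' n + βμn ≤ q`. [cite: Ruelle1969, §3.4] -/
theorem gcPressureTT'Zeeman_le_of_eventually {Ls : ℕ → ℕ} (hLs : Tendsto Ls atTop atTop) {q : ℝ}
    (hq : ∀ ε : ℝ, 0 < ε → ∀ᶠ j in atTop,
      Real.log (partitionFn β (hubbardRectTorusTT' (Ls j) (Ls j) t t' U - (μ : ℂ) • totalNumber - (hz : ℂ) • spinImbalance)).re ≤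
        (q + ε) * ((Ls j : ℕ) : ℝ) ^ 2) :
    gcPressureTT'Zeeman β t t' U μ hz ≤ q := by
  have hlim := tendsto_torusGCPressureTT'Zeeman_comp hβ t t' hU μ hz hLs
  refine le_of_forall_pos_le_add fun ε hε => ?_
  refine le_of_tendsto hlim ?_
  filter_upwards [hq ε hε, hLs.eventually_ge_atTop 1] with j hj hj1
  have hL2 : (0 : ℝ) < ((Ls j : ℕ) : ℝ) ^ 2 := by
    have : (1 : ℝ) ≤ ((Ls j : ℕ) : ℝ) := by exact_mod_cast hj1
    positivity
  rw [div_le_iff₀ hL2]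
  exact hj

/-- **Grand-canonical FLOORS are bounds on the number**: if along some `Ls → ∞`, for every `ε > 0` eventually
`(W − ε) L² ≤ log Re Z_β(H_L − μN)`, then `W ≤ P(μ)`. [cite: Ruelle1969, §3.4] -/
theorem le_gcPressureTT'Zeeman_of_eventually {Ls : ℕ → ℕ} (hLs : Tendsto Ls atTop atTop) {W : ℝ}
    (hW : ∀ ε : ℝ, 0 < ε → ∀ᶠ j in atTop,
      (W - ε) * ((Ls j : ℕ) : ℝ) ^ 2 ≤
        Real.log (partitionFn β (hubbardRectTorusTT' (Ls j) (Ls j) t t' U - (μ : ℂ) • totalNumber - (hz : ℂ) • spinImbalance)).re) :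
    W ≤ gcPressureTT'Zeeman β t t' U μ hz := by
  have hlim := tendsto_torusGCPressureTT'Zeeman_comp hβ t t' hU μ hz hLs
  refine le_of_forall_pos_le_add fun ε hε => ?_
  have h : W - ε ≤ gcPressureTT'Zeeman β t t' U μ hz := by
    refine ge_of_tendsto hlim ?_
    filter_upwards [hW ε hε, hLs.eventually_ge_atTop 1] with j hj hj1
    have hL2 : (0 : ℝ) < ((Ls j : ℕ) : ℝ) ^ 2 := by
      have : (1 : ℝ) ≤ ((Ls j : ℕ) : ℝ) := by exact_mod_cast hj1
      positivity
    rw [le_div_iff₀ hL2]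
    exact hj
  linarith

end GCZ

/-! ### §4 The field axis: `h = 0`, evenness, monotonicity in `|h|`, joint convexity in `(μ, h)` -/

section FieldAxis

variable {β : ℝ} (hβ : 0 ≤ β) (t t' : ℝ) {U : ℝ} (hU : 0 ≤ U)
include hβ hU

omit hβ hU in
/-- At zero field the Zeeman pressure is the grand-canonical pressure of `HubbardTTPrimeGrandCanonicalPressure`.
[cite: Ruelle1969, §3.4] -/
theorem gcPressureTT'Zeeman_zero (μ : ℝ) : gcPressureTT'Zeeman β t t' U μ 0 = gcPressureTT' β t t' U μ := by
  rw [gcPressureTT'Zeeman, gcPressureTT']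
  congr 1
  ext v
  simp

/-- **The Zeeman pressure is even in the field**: `P(μ, −h) = P(μ, h)` (spin-flip symmetry `p(x,y) = p(y,x)`).
[cite: LiebPRL1989, proof of Theorem 1] -/
theorem gcPressureTT'Zeeman_neg (μ hz : ℝ) : gcPressureTT'Zeeman β t t' U μ (-hz) = gcPressureTT'Zeeman β t t' U μ hz := by
  refine le_antisymm ?_ ?_
  · rw [gcPressureTT'Zeeman_le_iff hβ t t' hU]
    intro x y hx0 hx1 hy0 hy1
    have h := pressureTT'₂_add_le_gcPressureTT'Zeeman hβ t t' hU μ hz hy0 hy1 hx0 hx1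
    rw [pressureTT'₂_swap hβ t t' hU hy0 hy1 hx0 hx1] at h
    have e : β * μ * (y + x) + β * hz * (y - x) = β * μ * (x + y) + β * -hz * (x - y) := by ring
    linarith
  · rw [gcPressureTT'Zeeman_le_iff hβ t t' hU]
    intro x y hx0 hx1 hy0 hy1
    have h := pressureTT'₂_add_le_gcPressureTT'Zeeman hβ t t' hU μ (-hz) hy0 hy1 hx0 hx1
    rw [pressureTT'₂_swap hβ t t' hU hy0 hy1 hx0 hx1] at h
    have e : β * μ * (y + x) + β * -hz * (y - x) = β * μ * (x + y) + β * hz * (x - y) := by ring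
    linarith

/-- **A field never lowers the pressure**: `P(μ, 0) ≤ P(μ, h)` (evenness and convexity in `h`).
[cite: Ruelle1969, §3.4] -/
theorem gcPressureTT'Zeeman_zero_le (μ hz : ℝ) : gcPressureTT'Zeeman β t t' U μ 0 ≤ gcPressureTT'Zeeman β t t' U μ hz := by
  rw [gcPressureTT'Zeeman_le_iff hβ t t' hU]
  intro x y hx0 hx1 hy0 hy1
  have h1 := pressureTT'₂_add_le_gcPressureTT'Zeeman hβ t t' hU μ hz hx0 hx1 hy0 hy1
  have h2 := pressureTT'₂_add_le_gcPressureTT'Zeeman hβ t t' hU μ (-hz) hx0 hx1 hy0 hy1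
  rw [gcPressureTT'Zeeman_neg hβ t t' hU] at h2
  linarith

/-- **The grand-canonical pressure of record never exceeds the Zeeman pressure**: `gcPressureTT' μ ≤ P(μ, h)`.
[cite: Ruelle1969, §3.4] -/
theorem gcPressureTT'_le_gcPressureTT'Zeeman (μ hz : ℝ) : gcPressureTT' β t t' U μ ≤ gcPressureTT'Zeeman β t t' U μ hz := by
  rw [← gcPressureTT'Zeeman_zero (β := β) t t' (U := U) μ]
  exact gcPressureTT'Zeeman_zero_le hβ t t' hU μ hz

/-- **Joint convexity in `(μ, h)`** (a supremum of affine functions). [cite: Ruelle1969, §3.4] -/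
theorem convexOn_gcPressureTT'Zeeman :
    ConvexOn ℝ Set.univ (fun q : ℝ × ℝ => gcPressureTT'Zeeman β t t' U q.1 q.2) := by
  refine ⟨convex_univ, ?_⟩
  rintro ⟨μ₁, h₁⟩ - ⟨μ₂, h₂⟩ - θ θ' hθ hθ' hθθ'
  simp only [smul_eq_mul, Prod.mk_add_mk, Prod.smul_mk]
  rw [gcPressureTT'Zeeman_le_iff hβ t t' hU]
  intro x y hx0 hx1 hy0 hy1
  have e1 := pressureTT'₂_add_le_gcPressureTT'Zeeman hβ t t' hU μ₁ h₁ hx0 hx1 hy0 hy1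
  have e2 := pressureTT'₂_add_le_gcPressureTT'Zeeman hβ t t' hU μ₂ h₂ hx0 hx1 hy0 hy1
  have hθ'' : θ' = 1 - θ := by linarith
  rw [hθ'']
  rw [hθ''] at hθ'
  have e : pressureTT'₂ β t t' U x y + (β * (θ * μ₁ + (1 - θ) * μ₂) * (x + y) + β * (θ * h₁ + (1 - θ) * h₂) * (x - y)) =
      θ * (pressureTT'₂ β t t' U x y + (β * μ₁ * (x + y) + β * h₁ * (x - y))) +
        (1 - θ) * (pressureTT'₂ β t t' U x y + (β * μ₂ * (x + y) + β * h₂ * (x - y))) := by ring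
  rw [e]
  nlinarith [mul_le_mul_of_nonneg_left e1 hθ, mul_le_mul_of_nonneg_left e2 hθ']

end FieldAxis


end ThermodynamicLimit

end Literature.MathematicalPhysics.QuantumLattice
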